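import Summits.HubbardSuperconductivity.Statement
import Summits.HubbardSuperconductivity.HubbardSuperconductivity.Theorems.FunctionFieldCertificateAssemblyStructural
import HarnessLib

/-!
# Crux `WindowInfraredBound` (stmt-HubbardSuperconductivity-1089): what route `FunctionFieldCertificate` actually
# consumes of it — the infrared LEAK at the point of `MesoscopicPairOrder` (support theorems for the planners)

The deciding theorem of route `HubbardSuperconductivity/FunctionFieldCertificate` is
`closes : MesoscopicPairOrder → WindowInfraredBound → HubbardSuperconductivity`, proved structurally by
`functionFieldCertificate_assembly_structural` (p89257). Its proof uses the crux `WindowInfraredBound`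
(`∀ (U, δ) ∃ C, ε₀, L₀ ∀ ε ≤ ε₀ …  Σ_{m ≠ 0, |q_m| ≤ ε} S_ψ(m) ≤ C ε L²`) only ONCE: at the `(U, δ, m)` of
`MesoscopicPairOrder`, at the single window `ε := min ε₀ (m/(8(C+1)))`, through the budget
`Σ_{m ≠ 0, |q_m| ≤ ε} S_ψ(m) ≤ (m/8) · L²`. This file records, as kernel-checked theorems over the VERBATIM
bodies of the route decls (no definition is introduced), the weakest forms of the crux that keep the route closed:

* `summit_of_mesoscopicPairOrder_of_windowBudget` — ONE-POINT MERGED FORM: if at some `(U, δ)` there are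
  `m`, `b < m` and a window `ε > 0` such that (i) the Fejér-box `d`-wave pair correlation is `≥ m R²` at
  arbitrarily large block scales `R` (the body of `MesoscopicPairOrder` at that point) and (ii) the punctured
  window pair weight of every normalised `(N_L, 0)`-sector ground state is eventually `≤ b L²` (the summand and
  window of `WindowInfraredBound`, verbatim, at that ONE `ε`), then `HubbardSuperconductivity`; the LRO density
  obtained is `(m - b)/2`.
* `summit_of_mesoscopicPairOrder_of_infraredLeak` — DROP-IN FORM for `closes`: `MesoscopicPairOrder` (body
  verbatim) and the INFRARED LEAK `∀ (U, δ) ∀ b > 0 ∃ ε > 0 ∃ L₀ ∀ even L ≥ L₀ ∀ GS ψ: Σ_{m≠0,|q_m|≤ε} S_ψ(m) ≤ b L²`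
  (the crux with its linear rate `C ε` replaced by an arbitrary budget `b` at a `b`-dependent window) imply
  `HubbardSuperconductivity`.
* `infraredLeak_of_windowInfraredBound` — the leak is implied by the crux (`ε := min ε₀ (b/(C+1))`), so the
  restated route is no stronger than the filed one; composing the last two re-proves the filed Assembly
  (checked; not re-landed, it would duplicate `functionFieldCertificate_assembly_structural`).

Why this is recorded (planner-facing; five line leads and two escalated route provers recommended it in prose):
the `∀ (U, δ)`, linear-in-`ε` Σ-form of the crux is an RP-free `T = 0` infrared bound for the doped Hubbard
model with no engine in print, refutable pointwise by phase separation anywhere in `(0,∞) × (0,1/2)`; the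
route needs only the `o(1)` leak at its own point. The leak is still open physics (it excludes phase
separation with a paired component and pair-density waves with `|Q| → 0` at that point), but it carries no
rate, no uniformity in `ε`, and no quantifier over couplings the route never visits.

Proof: the structural assembly's argument with the window budget `b` in place of `C ε ≤ m/8`:
`Re⟨ψ, Δ_dᴴΔ_d ψ⟩/L⁴ ≥ Σ_a‖B_aψ‖²/(R⁴L²) - (window weight)/L² - K/R² ≥ m - b - (m-b)/8 ≥ (m-b)/2`
(`re_sum_star_blockMulVec_dotProduct_eq`, `WcbcsSsbToTorusLRO.stub_fejerClosure`, `K = 2π²C_d²/ε²`,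
`R ≥ ⌈8K/(m-b)⌉ + 1`), then `FunctionFieldCertificateAssemblyStructural.hasLRO_of_uniform_groundState_bound`.

Sources: Kennedy–Lieb–Shastry, PRL 61 (1988) 2582 [KLS1988PRL]; Dyson–Lieb–Simon, J. Stat. Phys. 18 (1978)
335, Thms 3.1–4.2 [DysonLiebSimon1978]; Scalapino, Phys. Rep. 250 (1995) 329, §2 eq. (2.4) [Scalapino1995];
the tree's `Theorems/FunctionFieldCertificateAssemblyStructural.lean` (adapted from). All folklore.
-/

noncomputable section

-- the summit namespace repeats the problem name by design (D-0017)
set_option linter.dupNamespace false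

namespace Summit.HubbardSuperconductivity.HubbardSuperconductivity.Theorems.WindowInfraredBound

open Matrix Finset Filter
open Literature.Probability.LatticeModels Literature.MathematicalPhysics.QuantumLattice
open scoped ComplexOrder
open FunctionFieldCertificateAssemblyStructural WcbcsSsbToTorusLRO

variable {L : ℕ} [NeZero L]

/-- The route's window sum (literal `if`-form over all momenta, window `|q_m|² ≤ ε²`, with
`D m = pairFieldAt dWaveFormFactor L m` by `rfl`) dominates the strict-window sum of
`stub_fejerClosure` (`|q_m|² < ε²`), termwise by `pairStructureFactor ≥ 0`.
(Copy of the private lemma of `FunctionFieldCertificateAssemblyStructural`.) [folklore] -/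
theorem leak_strictWindow_le_window (ε : ℝ) (ψ : Fock (Orb (FermionTorus 2 L))) :
    (∑ m ∈ (Finset.univ.filter fun m : TorusSite 2 L => m ≠ 0 ∧ momentumNormSq L m < ε ^ 2),
        pairStructureFactor dWaveFormFactor L ψ m) ≤
      ∑ m : Fin 2 → ZMod L, if m ≠ 0 ∧ (2 * Real.pi / (L : ℝ)) ^ 2 *
          (∑ i : Fin 2, (((m i).valMinAbs : ℤ) : ℝ) ^ 2) ≤ ε ^ 2 then
        (star (Matrix.mulVec (pairFieldAt dWaveFormFactor L m) ψ) ⬝ᵥ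
          Matrix.mulVec (pairFieldAt dWaveFormFactor L m) ψ).re / (L : ℝ) ^ 2 else 0 := by
  rw [← Finset.sum_filter]
  refine Finset.sum_le_sum_of_subset_of_nonneg (fun m hm => ?_) (fun m _ _ => ?_)
  · simp only [Finset.mem_filter, Finset.mem_univ, true_and] at hm ⊢
    exact ⟨hm.1, (le_of_eq (momentumNormSq_apply m).symm).trans hm.2.le⟩
  · exact pairStructureFactor_nonneg dWaveFormFactor L ψ m

/-- **One-point merged form — the weakest hypothesis under which the route's Fejér–Parseval glue closes.**
If at some `(U, δ)` there are reals `m`, `b < m` and a window radius `ε > 0` such that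
(i) [the body of `MesoscopicPairOrder` at that point] for every `R₀` some block scale `R ≥ R₀` has, for all
large even `L` and every normalised `(N_L, S^z = 0)`-sector ground state `ψ` of `hubbardTorus 2 L 1 U`,
Fejér-box `d`-wave pair correlation `≥ m R²`, and (ii) [the summand and window of `WindowInfraredBound`,
verbatim, at this one `ε`] the punctured-window pair weight `Σ_{m ≠ 0, |q_m| ≤ ε} ‖Δ_d(m)ψ‖²/L²` of every
such ground state is eventually `≤ b L²`, then `HubbardSuperconductivity` holds: every admissible ground-state
sequence has `d`-wave pair long-range order with density `≥ (m - b)/2`.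
Proof: Fejér closure `Σ_a‖B_aψ‖²/(R⁴L²) - window/L² - K/R² ≤ Re⟨Δ_dᴴΔ_d⟩/L⁴` with `K = 2π²C_d²/ε²` and
`R ≥ ⌈8K/(m-b)⌉ + 1`. Kennedy–Lieb–Shastry (1988); Scalapino (1995) §2 (2.4). [folklore] -/
theorem summit_of_mesoscopicPairOrder_of_windowBudget :
    (∃ U : ℝ, 0 < U ∧ ∃ δ ∈ Set.Ioo (0:ℝ) (1 / 2), ∃ m b ε : ℝ, b < m ∧ 0 < ε ∧ (∀ R₀ : ℕ, ∃ R : ℕ, R₀ ≤ R ∧ ∃ L₀ : ℕ, ∀ (L : ℕ) [NeZero L], L₀ ≤ L → Even L → ∀ ψ : Literature.MathematicalPhysics.QuantumLattice.Fock (Literature.MathematicalPhysics.QuantumLattice.Orb (Literature.MathematicalPhysics.QuantumLattice.FermionTorus 2 L)), star ψ ⬝ᵥ ψ = 1 → Literature.MathematicalPhysics.QuantumLattice.IsGroundStateInSector (Literature.MathematicalPhysics.QuantumLattice.hubbardTorus 2 L 1 U) (2 * ⌊(1 - δ) * (L : ℝ) ^ 2 / 2⌋₊) 0 ψ → m * (R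 : ℝ) ^ 2 ≤ (∑ x : Fin 2 → ZMod L, ∑ y : Fin 2 → ZMod L, (∏ i : Fin 2, max 0 (1 - |(((y i - x i).valMinAbs : ℤ) : ℝ)| / (R : ℝ))) * (star (Matrix.mulVec (Literature.MathematicalPhysics.QuantumLattice.localPair Literature.MathematicalPhysics.QuantumLattice.dWaveFormFactor L x) ψ) ⬝ᵥ Matrix.mulVec (Literature.MathematicalPhysics.QuantumLattice.localPair Literature.MathematicalPhysics.QuantumLattice.dWaveFormFactor L y) ψ).re) / (L : ℝ) ^ 2) ∧ (∃ L₀ : ℕ, ∀ (L : ℕ) [NeZero L], L₀ ≤ L → Even L → let D : (Fin 2 → ZMod L) → Matrix (Finset (Literature.MathematicalPhysics.QuantumLattice.Orb (Literature.MathematicalPhysics.QuantumLattice.FermionTorus 2 L))) (Finset (Literature.MathematicalPhysics.QuantumLattice.Orb (Literature.MathematicalPhysics.QuantumLattice.FermionTorus 2 L))) ℂ := fun m => ∑ x : Fin 2 → ZMod L, Complex.exp (-(2 * Real.pi * Complex.I * (((∑ i : Fin 2, m i * x i).val : ℕ) : ℂ) / (L : ℂ))) • Literature.MathematicalPhysics.QuantumLattice.localPair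 Literature.MathematicalPhysics.QuantumLattice.dWaveFormFactor L x; ∀ ψ : Literature.MathematicalPhysics.QuantumLattice.Fock (Literature.MathematicalPhysics.QuantumLattice.Orb (Literature.MathematicalPhysics.QuantumLattice.FermionTorus 2 L)), star ψ ⬝ᵥ ψ = 1 → Literature.MathematicalPhysics.QuantumLattice.IsGroundStateInSector (Literature.MathematicalPhysics.QuantumLattice.hubbardTorus 2 L 1 U) (2 * ⌊(1 - δ) * (L : ℝ) ^ 2 / 2⌋₊) 0 ψ → (∑ m : Fin 2 → ZMod L, if m ≠ 0 ∧ (2 * Real.pi / (L : ℝ)) ^ 2 * (∑ i : Fin 2, (((m i).valMinAbs : ℤ) : ℝ) ^ 2) ≤ ε ^ 2 then (star (Matrix.mulVec (D m) ψ) ⬝ᵥ Matrix.mulVec (D m) ψ).re / (L : ℝ) ^ 2 else 0) ≤ b * (L : ℝ) ^ 2)) →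
    _root_.HubbardSuperconductivity := by
  rintro ⟨U, hU, δ, hδ, m, b, ε, hbm, hεpos, hMeso, L₂, hW⟩
  -- constants
  set Cd : ℝ := ∑ e ∈ insert (0 : Site 2) unitSteps, ‖((dWaveFormFactor e / Real.sqrt 2 : ℝ) : ℂ)‖ * 2
    with hCd
  set c : ℝ := m - b with hc
  have hcpos : 0 < c := by rw [hc]; linarith
  set K : ℝ := 2 * Real.pi ^ 2 * Cd ^ 2 / ε ^ 2 with hK
  have hKnn : 0 ≤ K := by positivity
  obtain ⟨R, hR₀R, L₁, hM⟩ := hMeso (⌈8 * K / c⌉₊ + 1)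
  have hRpos : 0 < R := by omega
  have hRr : (0 : ℝ) < R := Nat.cast_pos.2 hRpos
  have hR8 : 8 * K / c ≤ (R : ℝ) :=
    (Nat.le_ceil _).trans (by exact_mod_cast (by omega : ⌈8 * K / c⌉₊ ≤ R))
  have htail : K / (R : ℝ) ^ 2 ≤ c / 8 := by
    have h1 : 8 * K ≤ c * R := by rw [div_le_iff₀ hcpos] at hR8; linarith
    have h2 : c * R ≤ c * (R : ℝ) ^ 2 := by
      have : (R : ℝ) ≤ (R : ℝ) ^ 2 := by
        have h1R : (1 : ℝ) ≤ R := by exact_mod_cast hRpos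
        nlinarith
      exact mul_le_mul_of_nonneg_left this hcpos.le
    rw [div_le_div_iff₀ (by positivity) (by norm_num : (0:ℝ) < 8)]
    linarith
  -- the uniform every-ground-state bound at `(U, δ)`
  have key : ∀ (L : ℕ) [NeZero L], max (max L₁ L₂) (2 * R) ≤ L → Even L →
      ∀ ψ : Fock (Orb (FermionTorus 2 L)),
      IsGroundStateInSector (hubbardTorus 2 L 1 U) (2 * ⌊(1 - δ) * (L : ℝ) ^ 2 / 2⌋₊) 0 ψ →
      star ψ ⬝ᵥ ψ = 1 →
      c / 2 * (L : ℝ) ^ 4 ≤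
        (star ψ ⬝ᵥ ((pairField dWaveFormFactor L)ᴴ * pairField dWaveFormFactor L) *ᵥ ψ).re := by
    intro L _ hL hev ψ hgs hψ
    have hL₁ : L₁ ≤ L := le_trans (le_trans (le_max_left _ _) (le_max_left _ _)) hL
    have hL₂ : L₂ ≤ L := le_trans (le_trans (le_max_right _ _) (le_max_left _ _)) hL
    have h2R : 2 * R ≤ L := le_trans (le_max_right _ _) hL
    have hLr : (0 : ℝ) < L := Nat.cast_pos.2 (Nat.pos_of_ne_zero (NeZero.ne L))
    -- (i): the Fejér-box average
    have hmeso := hM L hL₁ hev ψ hψ hgs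
    -- (ii): the window pair weight at `ε`
    have hwin₀ := hW L hL₂ hev
    have hwin : (∑ m ∈ (Finset.univ.filter fun m : TorusSite 2 L => m ≠ 0 ∧ momentumNormSq L m < ε ^ 2),
        pairStructureFactor dWaveFormFactor L ψ m) ≤ b * (L : ℝ) ^ 2 :=
      (leak_strictWindow_le_window ε ψ).trans (hwin₀ ψ hψ hgs)
    -- the Fejér closure of the tree
    have hstub := stub_fejerClosure dWaveFormFactor L R hRpos ε hεpos ψ hψ
    rw [FunctionFieldCertificateAssembly.re_sum_star_blockMulVec_dotProduct_eq R hRpos h2R] at hstub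
    -- the block term is `≥ m`
    have hblock : m ≤ (R : ℝ) ^ 2 * (∑ x : TorusSite 2 L, ∑ y : TorusSite 2 L,
        (∏ i : Fin 2, max 0 (1 - |(((y i - x i).valMinAbs : ℤ) : ℝ)| / (R : ℝ))) *
          (star (localPair dWaveFormFactor L x *ᵥ ψ) ⬝ᵥ (localPair dWaveFormFactor L y *ᵥ ψ)).re) /
        ((R : ℝ) ^ 4 * (L : ℝ) ^ 2) := by
      rw [le_div_iff₀ (by positivity)] at hmeso ⊢
      nlinarith [hmeso]
    -- the window term is `≤ b`
    have hwin' : (∑ m ∈ (Finset.univ.filter fun m : TorusSite 2 L => m ≠ 0 ∧ momentumNormSq L m < ε ^ 2),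
        pairStructureFactor dWaveFormFactor L ψ m) / (L : ℝ) ^ 2 ≤ b := by
      rw [div_le_iff₀ (by positivity)]
      exact hwin
    -- the tail term is `≤ c/8`
    have htail' : 2 * Real.pi ^ 2 * Cd ^ 2 / ((R : ℝ) ^ 2 * ε ^ 2) ≤ c / 8 := by
      have : 2 * Real.pi ^ 2 * Cd ^ 2 / ((R : ℝ) ^ 2 * ε ^ 2) = K / (R : ℝ) ^ 2 := by
        rw [hK]; field_simp
      rw [this]; exact htail
    -- assemble
    have hE : c / 2 ≤ (expect ((pairField dWaveFormFactor L)ᴴ * pairField dWaveFormFactor L) ψ).re /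
        (L : ℝ) ^ 4 := by rw [hc] at *; linarith
    rw [le_div_iff₀ (by positivity)] at hE
    exact hE
  -- conclude: the summit's matrix at `(U, δ)`
  show Literature.Hubbard.DWaveSuperconductivityHubbard
  exact ⟨U, hU, δ, hδ, fun N ψ hadm =>
    hasLRO_of_uniform_groundState_bound dWaveFormFactor (fun L => hubbardTorus 2 L 1 U)
      (fun L => 2 * ⌊(1 - δ) * (L : ℝ) ^ 2 / 2⌋₊) 0 (c / 2) (by positivity) (max (max L₁ L₂) (2 * R))
      (fun L _ hL hev φ hgs hφ => key L hL hev φ hgs hφ) N ψ hadm⟩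

/-- **Drop-in form for the route's `closes`: `MesoscopicPairOrder` + the infrared LEAK ⇒ summit.**
Hypothesis 1 is the body of `Theses.FunctionFieldCertificate.MesoscopicPairOrder` verbatim; hypothesis 2
is the INFRARED LEAK — the crux `WindowInfraredBound` with its linear rate `C ε L²` (one `C`, all
`ε ≤ ε₀`) replaced by an arbitrary budget `b L²` at ONE `b`-dependent window `ε`:
`∀ U > 0, ∀ δ ∈ (0,1/2), ∀ b > 0, ∃ ε > 0, ∃ L₀, ∀ even L ≥ L₀, ∀ normalised (N_L,0)-sector GS ψ,
Σ_{m ≠ 0, |q_m| ≤ ε} ‖Δ_d(m)ψ‖²/L² ≤ b L²` (summand and window condition verbatim those of the crux).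
Proof: the leak at the point and with the budget `b := m/2` of hypothesis 1, then
`summit_of_mesoscopicPairOrder_of_windowBudget`. [folklore] -/
theorem summit_of_mesoscopicPairOrder_of_infraredLeak :
    (∃ U : ℝ, 0 < U ∧ ∃ δ ∈ Set.Ioo (0:ℝ) (1 / 2), ∃ m : ℝ, 0 < m ∧ ∀ R₀ : ℕ, ∃ R : ℕ, R₀ ≤ R ∧ ∃ L₀ : ℕ, ∀ (L : ℕ) [NeZero L], L₀ ≤ L → Even L → ∀ ψ : Literature.MathematicalPhysics.QuantumLattice.Fock (Literature.MathematicalPhysics.QuantumLattice.Orb (Literature.MathematicalPhysics.QuantumLattice.FermionTorus 2 L)), star ψ ⬝ᵥ ψ = 1 → Literature.MathematicalPhysics.QuantumLattice.IsGroundStateInSector (Literature.MathematicalPhysics.QuantumLattice.hubbardTorus 2 L 1 U) (2 * ⌊(1 - δ) * (L : ℝ) ^ 2 / 2⌋₊) 0 ψ → m * (R : ℝ) ^ 2 ≤ (∑ x : Fin 2 → ZMod L, ∑ y : Fin 2 → ZMod L, (∏ i : Fin 2, max 0 (1 - |(((y i - x i).valMinAbs : ℤ) : ℝ)| / (R : ℝ)))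 * (star (Matrix.mulVec (Literature.MathematicalPhysics.QuantumLattice.localPair Literature.MathematicalPhysics.QuantumLattice.dWaveFormFactor L x) ψ) ⬝ᵥ Matrix.mulVec (Literature.MathematicalPhysics.QuantumLattice.localPair Literature.MathematicalPhysics.QuantumLattice.dWaveFormFactor L y) ψ).re) / (L : ℝ) ^ 2) →
    (∀ U : ℝ, 0 < U → ∀ δ ∈ Set.Ioo (0:ℝ) (1 / 2), ∀ b : ℝ, 0 < b → ∃ ε : ℝ, 0 < ε ∧ ∃ L₀ : ℕ, ∀ (L : ℕ) [NeZero L], L₀ ≤ L → Even L → let D : (Fin 2 → ZMod L) → Matrix (Finset (Literature.MathematicalPhysics.QuantumLattice.Orb (Literature.MathematicalPhysics.QuantumLattice.FermionTorus 2 L))) (Finset (Literature.MathematicalPhysics.QuantumLattice.Orb (Literature.MathematicalPhysics.QuantumLattice.FermionTorus 2 L))) ℂ := fun m => ∑ x : Fin 2 → ZMod L, Complex.exp (-(2 * Real.pi * Complex.I * (((∑ i : Fin 2, m i * x i).val : ℕ) : ℂ) / (L : ℂ))) • Literature.MathematicalPhysics.QuantumLattice.localPair Literature.MathematicalPhysics.QuantumLattice.dWaveFormFactor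 L x; ∀ ψ : Literature.MathematicalPhysics.QuantumLattice.Fock (Literature.MathematicalPhysics.QuantumLattice.Orb (Literature.MathematicalPhysics.QuantumLattice.FermionTorus 2 L)), star ψ ⬝ᵥ ψ = 1 → Literature.MathematicalPhysics.QuantumLattice.IsGroundStateInSector (Literature.MathematicalPhysics.QuantumLattice.hubbardTorus 2 L 1 U) (2 * ⌊(1 - δ) * (L : ℝ) ^ 2 / 2⌋₊) 0 ψ → (∑ m : Fin 2 → ZMod L, if m ≠ 0 ∧ (2 * Real.pi / (L : ℝ)) ^ 2 * (∑ i : Fin 2, (((m i).valMinAbs : ℤ) : ℝ) ^ 2) ≤ ε ^ 2 then (star (Matrix.mulVec (D m) ψ) ⬝ᵥ Matrix.mulVec (D m) ψ).re / (L : ℝ) ^ 2 else 0) ≤ b * (L : ℝ) ^ 2) →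
    _root_.HubbardSuperconductivity := by
  rintro ⟨U, hU, δ, hδ, m, hm, hMeso⟩ hLeak
  obtain ⟨ε, hε, hB⟩ := hLeak U hU δ hδ (m / 2) (by positivity)
  exact summit_of_mesoscopicPairOrder_of_windowBudget
    ⟨U, hU, δ, hδ, m, m / 2, ε, by linarith, hε, hMeso, hB⟩

/-- **The crux implies the leak** (so restating the route's pole half as the leak weakens it): given
`WindowInfraredBound`'s `(C, ε₀, L₀)` at `(U, δ)` and a budget `b > 0`, the window `ε := min ε₀ (b/(C+1))`
has `C ε ≤ b`, hence `Σ_{m ≠ 0, |q_m| ≤ ε} ‖Δ_d(m)ψ‖²/L² ≤ C ε L² ≤ b L²` for all even `L ≥ L₀` and every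
normalised sector ground state. Both bodies verbatim (`Theses.FunctionFieldCertificate.WindowInfraredBound` =
`Theses.KacWindowPenalty.WindowInfraredBound`). [folklore] -/
theorem infraredLeak_of_windowInfraredBound :
    (∀ U : ℝ, 0 < U → ∀ δ ∈ Set.Ioo (0:ℝ) (1 / 2), ∃ C ε₀ : ℝ, 0 ≤ C ∧ 0 < ε₀ ∧ ∃ L₀ : ℕ, ∀ ε ∈ Set.Ioc (0:ℝ) ε₀, ∀ (L : ℕ) [NeZero L], L₀ ≤ L → Even L → let D : (Fin 2 → ZMod L) → Matrix (Finset (Literature.MathematicalPhysics.QuantumLattice.Orb (Literature.MathematicalPhysics.QuantumLattice.FermionTorus 2 L))) (Finset (Literature.MathematicalPhysics.QuantumLattice.Orb (Literature.MathematicalPhysics.QuantumLattice.FermionTorus 2 L))) ℂ := fun m => ∑ x : Fin 2 → ZMod L, Complex.exp (-(2 * Real.pi * Complex.I * (((∑ i : Fin 2, m i * x i).val : ℕ) : ℂ) / (L : ℂ))) • Literature.MathematicalPhysics.QuantumLattice.localPair Literature.MathematicalPhysics.QuantumLattice.dWaveFormFactor L x; ∀ ψ : Literature.MathematicalPhysics.QuantumLattice.Fock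 (Literature.MathematicalPhysics.QuantumLattice.Orb (Literature.MathematicalPhysics.QuantumLattice.FermionTorus 2 L)), star ψ ⬝ᵥ ψ = 1 → Literature.MathematicalPhysics.QuantumLattice.IsGroundStateInSector (Literature.MathematicalPhysics.QuantumLattice.hubbardTorus 2 L 1 U) (2 * ⌊(1 - δ) * (L : ℝ) ^ 2 / 2⌋₊) 0 ψ → (∑ m : Fin 2 → ZMod L, if m ≠ 0 ∧ (2 * Real.pi / (L : ℝ)) ^ 2 * (∑ i : Fin 2, (((m i).valMinAbs : ℤ) : ℝ) ^ 2) ≤ ε ^ 2 then (star (Matrix.mulVec (D m) ψ) ⬝ᵥ Matrix.mulVec (D m) ψ).re / (L : ℝ) ^ 2 else 0) ≤ C * ε * (L : ℝ) ^ 2) →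
    (∀ U : ℝ, 0 < U → ∀ δ ∈ Set.Ioo (0:ℝ) (1 / 2), ∀ b : ℝ, 0 < b → ∃ ε : ℝ, 0 < ε ∧ ∃ L₀ : ℕ, ∀ (L : ℕ) [NeZero L], L₀ ≤ L → Even L → let D : (Fin 2 → ZMod L) → Matrix (Finset (Literature.MathematicalPhysics.QuantumLattice.Orb (Literature.MathematicalPhysics.QuantumLattice.FermionTorus 2 L))) (Finset (Literature.MathematicalPhysics.QuantumLattice.Orb (Literature.MathematicalPhysics.QuantumLattice.FermionTorus 2 L))) ℂ := fun m => ∑ x : Fin 2 → ZMod L, Complex.exp (-(2 * Real.pi * Complex.I * (((∑ i : Fin 2, m i * x i).val : ℕ) : ℂ) / (L : ℂ))) • Literature.MathematicalPhysics.QuantumLattice.localPair Literature.MathematicalPhysics.QuantumLattice.dWaveFormFactor L x; ∀ ψ : Literature.MathematicalPhysics.QuantumLattice.Fock (Literature.MathematicalPhysics.QuantumLattice.Orb (Literature.MathematicalPhysics.QuantumLattice.FermionTorus 2 L)), star ψ ⬝ᵥ ψ = 1 → Literature.MathematicalPhysics.QuantumLattice.IsGroundStateInSector (Literature.MathematicalPhysics.QuantumLattice.hubbardTorus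 2 L 1 U) (2 * ⌊(1 - δ) * (L : ℝ) ^ 2 / 2⌋₊) 0 ψ → (∑ m : Fin 2 → ZMod L, if m ≠ 0 ∧ (2 * Real.pi / (L : ℝ)) ^ 2 * (∑ i : Fin 2, (((m i).valMinAbs : ℤ) : ℝ) ^ 2) ≤ ε ^ 2 then (star (Matrix.mulVec (D m) ψ) ⬝ᵥ Matrix.mulVec (D m) ψ).re / (L : ℝ) ^ 2 else 0) ≤ b * (L : ℝ) ^ 2) := by
  intro hW U hU δ hδ b hb
  obtain ⟨C, ε₀, hC, hε₀, L₀, h⟩ := hW U hU δ hδ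
  have hC1 : 0 < C + 1 := by linarith
  refine ⟨min ε₀ (b / (C + 1)), lt_min hε₀ (by positivity), L₀, ?_⟩
  intro L _ hL hev D ψ hψ hgs
  have hεmem : min ε₀ (b / (C + 1)) ∈ Set.Ioc (0 : ℝ) ε₀ := ⟨lt_min hε₀ (by positivity), min_le_left _ _⟩
  have hCε : C * min ε₀ (b / (C + 1)) ≤ b := by
    calc C * min ε₀ (b / (C + 1)) ≤ (C + 1) * (b / (C + 1)) :=
          mul_le_mul (by linarith) (min_le_right _ _) (lt_min hε₀ (by positivity)).le hC1.le
      _ = b := by field_simp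
  have hLr : (0 : ℝ) ≤ (L : ℝ) ^ 2 := by positivity
  exact (h _ hεmem L hL hev ψ hψ hgs).trans (mul_le_mul_of_nonneg_right hCε hLr)

/- Consistency (checked in the lead's work folder, not landed to avoid a duplicate statement): the filed
Assembly `MesoscopicPairOrder → WindowInfraredBound → HubbardSuperconductivity` is
`fun hMeso hWindow => summit_of_mesoscopicPairOrder_of_infraredLeak hMeso (infraredLeak_of_windowInfraredBound hWindow)`. -/

end Summit.HubbardSuperconductivity.HubbardSuperconductivity.Theorems.WindowInfraredBound

end
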